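import Summits.QuantumFields.YangMills.Theorems.BalabanUVNodesN15KingModelFullPropagatorGrad

/-!
# BalabanUVNodes ∕ N15 — THE KING-MODEL RUNG, CURVED EDITION (PART O-b′): THE TWO-SPACING η-RATE OF THE GRADIENT OF THE FULL
# `A = 0` FLUCTUATION PROPAGATOR — `|∂^{η′}_μG^{η′}_{K+n}(x′, y′) − ∂^η_μG^η_K(x, y)| ≤ C·(L^{−γ∕2})^K·e^{−δ|B(x) − B(y)|}` off the
# diagonal, uniform in `K`, `n`, the volume and the mass, by the PAIRED induction of part O-b on the differentiated peels
# (King's Prop. 3.8 (3.71) SECOND-LINE SHAPE for the full propagator of (2.13))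
# (Track A, DAG node N15 = NE2; FAN-OUT v1.1 §N15 s3 «KING-MODEL RUNG … + the one-line statement of what the curved case adds»)

HONEST FRAMING.  Count-neutral kernel bookkeeping (cell `pub-ymgap`, seat `pub-ymgap-dag-n15-e` g6; `--supports stmt-QuantumFields-19912
--as helper` = K3‴ `SpineGivenEndpointR13`, lineage K3 19676 → K3′ 19908).  TEMPLATE LITERATURE, `A = 0`: C. King's scalar U(1)-Higgs MODEL
on finite tori ([King1986] (2.13)–(2.17) p. 653, (2.20) p. 654, Prop. 3.8 (3.71) p. 664 (the printed second line is for `∂^ηℋ_k`, the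
minimiser — the full-propagator version below is its (2.17)-summed analogue, NOT a printed proposition), §4 p. 675 (4.42)–(4.43)), NOT
Bałaban's covariant objects; NE2⁺ is NOT PRINTED for those and not proved here; NOT a node discharge; nothing continuum ∕ ℝ⁴ ∕ OS ∕
mass-gap ∕ Clay.  0 `sorry`, 0 `def`, standard axioms.

THE POINT.  Part O-b (`…FullPropagatorRate`, `fullProp_rate_unif`) proved the two-spacing η-rate of King's full `A = 0` fluctuation propagator
off the diagonal; part O-a′ (`…FullPropagatorGrad`, `fullPropD_decay_unif`) the uniform decay of its forward η-derivative
`∂G(K)_μ(x, y) = L^K·[G(K)(x + e_μ, y) − G(K)(x, y)]`.  THIS FILE runs part O-b's paired induction on the derivative: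
* §1 `ksDSlice'_eq_fwdDiff` (the fine gradient piece of part H IS `L^nL^K` times the forward difference of the fine slice — the fine twin of
  part K's `ksDSlice_eq_fwdDiff`), **`fullPropD_peel_fine`** (the differentiated peel of the fine run: `TorusCongr.torCongr_unitVec` + K-lit
  `flatten_unitVec` carry the lattice step through the re-indexings, then part O-b `fullProp_peel_fine'` at `x′ + e_μ` and `x′`),
  `fullPropD_peel_pair_abs_le` (the difference of the two differentiated peels);
* §2 **`fullPropD_rate_unif`** — `∃ C δ > 0, D₀ ≥ 1` (functions of `d, L, a, m₀², γ`; `0 ≤ γ < 1`) such that for EVERY `K ≥ 1`, `n ≥ 1`, cube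
  `M_μ = 2L^e`, mass `0 < m² ≤ m₀²`, direction `μ` and fine `x′, y′` over `x, y` with `|B(x) − B(y)|_M ≥ D₀`:
  `|∂G(K+n, M, m²)_μ(x′, y′) − ∂G(K, M, m²)_μ(x, y)| ≤ C·(L^{−γ∕2})^K·e^{−δ|B(x) − B(y)|_M}`.  PAIRED INDUCTION ON `K`: base `K = 1` = part
  O-a′ on both runs (`2C₁ ≤ (2C₁L)·L^{−γ∕2}`); step = §1's pair of peels at the same index and mass `m²∕L²`, the induction hypothesis on the
  finer cube, part M′ `ksDSlice_rate_unif` at the finer block distance `D_sub ≥ L(D − 1) + 1`, and the gain `A·e^{−A} ≤ 1` (`A = 2L^{d+1}`)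
  times the spare `L⁻¹ ≤ L^{−γ∕2}`.
WHAT THE CURVED CASE ADDS (one line): Bałaban's `∇_U G_k(U)` ([B9] (3.42) entries with one covariant derivative), uniformly over the live
window `Reg335`; print gives analyticity in `U` and η-uniformity (Thm 3.4), never an η-difference.
HONEST SCOPE.  (i) `A = 0`, periodic b.c., odd `L ≥ 3`, `0 < m² ≤ m₀²`, cubes `2L^e`; (ii) lattice units of level `K`; (iii) OFF-DIAGONAL;
(iv) `K, n ≥ 1`, `0 ≤ γ < 1` (the tree's Prop. 3.8 second line); (v) not Bałaban's `∇G_k(U)`; not a discharge.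
Locators: [King1986] C. King, CMP **102** (1986) 649–677: (2.13)–(2.17) p. 653, (2.20) p. 654, Prop. 3.8 (3.71) p. 664 (second line, shape; p. 664
«x′ ∈ B^n(x)»), (4.42)–(4.43) p. 675; [B9] = [Balaban1985BackgroundPropagators] Thm 3.1 (3.42) p. 397 + Thm 3.14 pp. 426–427 (typing template).
-/

noncomputable section

namespace Summit.QuantumFields.YangMills.BalabanUVNodes.N15KingModelRung.Curved

open Real Finset Matrix
open Literature.MathematicalPhysics.QuantumFieldTheory.Balaban1983to89.B5Prop11Plancherel (Tor fine unitVec)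
open Literature.MathematicalPhysics.QuantumFieldTheory.King1986 (aK aK_pos)
open Literature.MathematicalPhysics.QuantumFieldTheory.King1986.Torus (constrainedProp flatten blockOf tdistT torCongr
  torCongr_add torCongr_unitVec flatten_add flatten_unitVec blockOf_flatten tdistT_nonneg)

variable {d : ℕ} (L : ℕ) [NeZero L]

/-! ## §1 The differentiated peel of the fine run -/

/-- **The fine gradient piece is a forward difference of the fine slice**: `ksDSlice′_μ(x′, y′) = L^nL^K·(ksSlice′(x′ + e_μ, y′) − ksSlice′(x′, y′))`
(the fine twin of part K's `ksDSlice_eq_fwdDiff`; `∂^{η′}_μ` with `η′⁻¹ = L^nL^K` acts on the first leg, the contraction is linear in it).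
[cite: King1986, (4.42) p.675, Prop. 3.9 (3.73) p.665 (second line, object)] -/
theorem ksDSlice'_eq_fwdDiff (a m2 : ℝ) (i : KSliceIdx d) (μ : Fin (d + 1)) (x' y' : Tor (fine (L ^ i.n * L ^ i.j) (ksU L i))) :
    ksDSlice' L a m2 i μ x' y'
      = ((L ^ i.n * L ^ i.j : ℕ) : ℝ) *
          (ksSlice' L a m2 i (x' + unitVec (fine (L ^ i.n * L ^ i.j) (ksU L i)) μ) y' - ksSlice' L a m2 i x' y') := by
  rw [ksDSlice', ksSlice', ksSlice', ← triple_sub_left, ← triple_smul_left]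
  rfl

/-- **THE DIFFERENTIATED PEEL OF THE FINE RUN**: for the slice index `i = (e, K = i.j, n = i.n, …)`, `a > 0`, `m² > 0`, `L ≥ 2`, direction `μ`,
fine points `x′, y′` of the nested torus and the spelling bridge `h`:
`L^nL^{K+1}·[G(K+1+n, M_e, m²)(e(flatten x′) + e_μ, e(flatten y′)) − G(K+1+n, M_e, m²)(e(flatten x′), e(flatten y′))]
= (L^{d+1}∕L²)·L·[L^nL^K·(G(K+n, fine L M_e, m²∕L²)(x′ + e_μ, y′) − G(K+n, fine L M_e, m²∕L²)(x′, y′)) + ksDSlice′ (m²∕L²) i μ (x′, y′)]`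
(`torCongr_unitVec`, `flatten_unitVec`: the re-indexed lattice step is the nested lattice step; part O-b `fullProp_peel_fine'` twice; §1).
[cite: King1986, (2.17) p.653, (2.20) p.654, Prop. 3.9 (3.73) p.665 (second line, object), (4.42) p.675] -/
theorem fullPropD_peel_fine (hL : 2 ≤ L) {a msq : ℝ} (ha : 0 < a) (hm : 0 < msq) (i : KSliceIdx d) (μ : Fin (d + 1))
    (x' y' : Tor (fine (L ^ i.n * L ^ i.j) (ksU L i)))
    (h : ∀ ν, fine (L ^ i.n * L ^ i.j * L) (ksM L i) ν = fine (L ^ i.n * L ^ (i.j + 1)) (ksM L i) ν) :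
    ((L ^ i.n * L ^ (i.j + 1) : ℕ) : ℝ) *
        (constrainedProp (L ^ i.n * L ^ (i.j + 1)) (ksM L i) (aK a L (i.j + 1 + i.n))
            (((L ^ i.n * L ^ (i.j + 1) : ℕ) : ℝ) ^ 2) msq
            (torCongr h (flatten (L ^ i.n * L ^ i.j) L (ksM L i) x') + unitVec (fine (L ^ i.n * L ^ (i.j + 1)) (ksM L i)) μ)
            (torCongr h (flatten (L ^ i.n * L ^ i.j) L (ksM L i) y'))
          - constrainedProp (L ^ i.n * L ^ (i.j + 1)) (ksM L i) (aK a L (i.j + 1 + i.n))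
            (((L ^ i.n * L ^ (i.j + 1) : ℕ) : ℝ) ^ 2) msq
            (torCongr h (flatten (L ^ i.n * L ^ i.j) L (ksM L i) x')) (torCongr h (flatten (L ^ i.n * L ^ i.j) L (ksM L i) y')))
      = (L : ℝ) ^ (d + 1) / (L : ℝ) ^ 2 * L *
          (((L ^ i.n * L ^ i.j : ℕ) : ℝ) *
              (constrainedProp (L ^ i.n * L ^ i.j) (ksU L i) (aK a L (i.j + i.n)) (((L ^ i.n * L ^ i.j : ℕ) : ℝ) ^ 2)
                  (msq / (L : ℝ) ^ 2) (x' + unitVec (fine (L ^ i.n * L ^ i.j) (ksU L i)) μ) y'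
                - constrainedProp (L ^ i.n * L ^ i.j) (ksU L i) (aK a L (i.j + i.n)) (((L ^ i.n * L ^ i.j : ℕ) : ℝ) ^ 2)
                  (msq / (L : ℝ) ^ 2) x' y')
            + ksDSlice' L a (msq / (L : ℝ) ^ 2) i μ x' y') := by
  rw [← torCongr_unitVec h μ, ← torCongr_add, ← flatten_unitVec (L ^ i.n * L ^ i.j) L (ksM L i) μ, ← flatten_add,
    fullProp_peel_fine' L hL ha hm i (x' + _) y' h, fullProp_peel_fine' L hL ha hm i x' y' h, ksDSlice'_eq_fwdDiff]
  push_cast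
  ring

/-- **The difference of the two differentiated peels, triangle-inequality form**: at the same index and mass,
`|∂G(K+1+n)(e x̂′, e ŷ′) − ∂G(K+1)(x̂, ŷ)| ≤ (L^{d+1}∕L²)·L·(|∂G(K+n)^{sub}(x′, y′) − ∂G(K)^{sub}(x, y)| + |ksDSlice′(x′, y′) − ksDSlice(x, y)|)`.
[cite: King1986, (2.17) p.653, (4.42)–(4.43) p.675] -/
theorem fullPropD_peel_pair_abs_le (hL : 2 ≤ L) {a msq : ℝ} (ha : 0 < a) (hm : 0 < msq) (i : KSliceIdx d) (μ : Fin (d + 1))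
    (x' y' : Tor (fine (L ^ i.n * L ^ i.j) (ksU L i))) (x y : Tor (fine (L ^ i.j) (ksU L i)))
    (h : ∀ ν, fine (L ^ i.n * L ^ i.j * L) (ksM L i) ν = fine (L ^ i.n * L ^ (i.j + 1)) (ksM L i) ν) :
    |((L ^ i.n * L ^ (i.j + 1) : ℕ) : ℝ) *
          (constrainedProp (L ^ i.n * L ^ (i.j + 1)) (ksM L i) (aK a L (i.j + 1 + i.n))
              (((L ^ i.n * L ^ (i.j + 1) : ℕ) : ℝ) ^ 2) msq
              (torCongr h (flatten (L ^ i.n * L ^ i.j) L (ksM L i) x') + unitVec (fine (L ^ i.n * L ^ (i.j + 1)) (ksM L i)) μ)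
              (torCongr h (flatten (L ^ i.n * L ^ i.j) L (ksM L i) y'))
            - constrainedProp (L ^ i.n * L ^ (i.j + 1)) (ksM L i) (aK a L (i.j + 1 + i.n))
              (((L ^ i.n * L ^ (i.j + 1) : ℕ) : ℝ) ^ 2) msq
              (torCongr h (flatten (L ^ i.n * L ^ i.j) L (ksM L i) x')) (torCongr h (flatten (L ^ i.n * L ^ i.j) L (ksM L i) y')))
        - ((L ^ i.j * L : ℕ) : ℝ) *
          (constrainedProp (L ^ i.j * L) (ksM L i) (aK a L (i.j + 1)) (((L ^ i.j * L : ℕ) : ℝ) ^ 2) msq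
              (flatten (L ^ i.j) L (ksM L i) x + unitVec (fine (L ^ i.j * L) (ksM L i)) μ) (flatten (L ^ i.j) L (ksM L i) y)
            - constrainedProp (L ^ i.j * L) (ksM L i) (aK a L (i.j + 1)) (((L ^ i.j * L : ℕ) : ℝ) ^ 2) msq
              (flatten (L ^ i.j) L (ksM L i) x) (flatten (L ^ i.j) L (ksM L i) y))|
      ≤ (L : ℝ) ^ (d + 1) / (L : ℝ) ^ 2 * L *
          (|((L ^ i.n * L ^ i.j : ℕ) : ℝ) *
                (constrainedProp (L ^ i.n * L ^ i.j) (ksU L i) (aK a L (i.j + i.n)) (((L ^ i.n * L ^ i.j : ℕ) : ℝ) ^ 2)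
                    (msq / (L : ℝ) ^ 2) (x' + unitVec (fine (L ^ i.n * L ^ i.j) (ksU L i)) μ) y'
                  - constrainedProp (L ^ i.n * L ^ i.j) (ksU L i) (aK a L (i.j + i.n)) (((L ^ i.n * L ^ i.j : ℕ) : ℝ) ^ 2)
                    (msq / (L : ℝ) ^ 2) x' y')
              - ((L ^ i.j : ℕ) : ℝ) *
                (constrainedProp (L ^ i.j) (ksU L i) (aK a L i.j) (((L ^ i.j : ℕ) : ℝ) ^ 2) (msq / (L : ℝ) ^ 2)
                    (x + unitVec (fine (L ^ i.j) (ksU L i)) μ) y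
                  - constrainedProp (L ^ i.j) (ksU L i) (aK a L i.j) (((L ^ i.j : ℕ) : ℝ) ^ 2) (msq / (L : ℝ) ^ 2) x y)|
            + |ksDSlice' L a (msq / (L : ℝ) ^ 2) i μ x' y' - ksDSlice L a (msq / (L : ℝ) ^ 2) i μ x y|) := by
  have hΛ : 0 ≤ (L : ℝ) ^ (d + 1) / (L : ℝ) ^ 2 * L := by positivity
  rw [fullPropD_peel_fine L hL ha hm i μ x' y' h, fullPropD_peel L hL ha hm i μ x y, ← mul_sub, abs_mul, abs_of_nonneg hΛ]
  refine mul_le_mul_of_nonneg_left ?_ hΛ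
  have e : ∀ (p q r s : ℝ), p + q - (r + s) = (p - r) + (q - s) := fun p q r s => by ring
  rw [e]
  exact abs_add_le _ _

/-! ## §2 The two-spacing η-rate of the gradient of the full propagator -/

/-- **THE TWO-SPACING η-RATE OF THE GRADIENT OF KING'S FULL `A = 0` FLUCTUATION PROPAGATOR** (Prop. 3.8 (3.71) SECOND-LINE SHAPE for the
covariance of (2.13); the (2.17)-summed analogue of the printed minimiser statement): for odd `L ≥ 3`, `a > 0`, a mass cap `m₀² ≥ 0` and
`0 ≤ γ < 1` there are `C, δ > 0` and `D₀ ≥ 1` (functions of `d, L, a, m₀², γ`) such that for EVERY `K ≥ 1`, `n ≥ 1`, cube `M_μ = 2L^e`, mass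
`0 < m² ≤ m₀²`, direction `μ` and all fine points `x′, y′` of the `(K+n)`-level run over `x, y` (King's pairing `underPtN`) with
`|B(x) − B(y)|_M ≥ D₀`:  `|∂^{η′}_μG^{η′}_{K+n}(x′, y′) − ∂^η_μG^η_K(x, y)| ≤ C·(L^{−γ∕2})^K·e^{−δ·|B(x) − B(y)|_M}`, the derivatives being the forward
differences times `L^nL^K` ∕ `L^K` of King's `constrainedProp` at the same mass.  Paired induction on `K` (module docstring).
[cite: King1986, (2.13)–(2.17) p.653, (2.20) p.654, Prop. 3.8 (3.71) p.664 (second line), (4.42)–(4.43) p.675] -/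
theorem fullPropD_rate_unif (hLodd : Odd L) (hL : 2 ≤ L) {a : ℝ} (ha : 0 < a) {m0sq : ℝ} (hm0 : 0 ≤ m0sq) {γ : ℝ}
    (hγ0 : 0 ≤ γ) (hγ1 : γ < 1) :
    ∃ C δ D₀ : ℝ, 0 < C ∧ 0 < δ ∧ 1 ≤ D₀ ∧ ∀ (K : ℕ), 1 ≤ K → ∀ (n : ℕ), 1 ≤ n →
      ∀ (e : ℕ) (M : Fin (d + 1) → ℕ) [∀ μ, NeZero (M μ)], (∀ μ, M μ = 2 * L ^ e) →
      ∀ (msq : ℝ), 0 < msq → msq ≤ m0sq →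
      ∀ (μ : Fin (d + 1)) (x' y' : Tor (fine (L ^ n * L ^ K) M)),
        D₀ ≤ tdistT M (blockOf (L ^ K) M (underPtN L K n M x')) (blockOf (L ^ K) M (underPtN L K n M y')) →
        |((L ^ n * L ^ K : ℕ) : ℝ) *
              (constrainedProp (L ^ n * L ^ K) M (aK a L (K + n)) (((L ^ n * L ^ K : ℕ) : ℝ) ^ 2) msq
                  (x' + unitVec (fine (L ^ n * L ^ K) M) μ) y'
                - constrainedProp (L ^ n * L ^ K) M (aK a L (K + n)) (((L ^ n * L ^ K : ℕ) : ℝ) ^ 2) msq x' y')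
            - ((L ^ K : ℕ) : ℝ) *
              (constrainedProp (L ^ K) M (aK a L K) (((L ^ K : ℕ) : ℝ) ^ 2) msq
                  (underPtN L K n M x' + unitVec (fine (L ^ K) M) μ) (underPtN L K n M y')
                - constrainedProp (L ^ K) M (aK a L K) (((L ^ K : ℕ) : ℝ) ^ 2) msq
                  (underPtN L K n M x') (underPtN L K n M y'))|
          ≤ C * (((L : ℝ) ^ (-(γ / 2))) ^ K)
              * Real.exp (-(δ * tdistT M (blockOf (L ^ K) M (underPtN L K n M x'))
                  (blockOf (L ^ K) M (underPtN L K n M y')))) := by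
  have hL1 : 1 < L := by omega
  have hL1' : (1 : ℝ) ≤ L := by exact_mod_cast hL1.le
  have hL0 : (0 : ℝ) < L := by positivity
  have hLm1 : (1 : ℝ) ≤ (L : ℝ) - 1 := by
    have : (2 : ℝ) ≤ L := by exact_mod_cast hL
    linarith
  -- the rate `θ = L^{−γ∕2} ∈ [L⁻¹, 1]`
  set θ : ℝ := (L : ℝ) ^ (-(γ / 2)) with hθdef
  have hθ0 : 0 < θ := Real.rpow_pos_of_pos hL0 _
  have hθL : (L : ℝ)⁻¹ ≤ θ := by
    rw [hθdef, ← Real.rpow_neg_one]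
    exact Real.rpow_le_rpow_of_exponent_le hL1' (by linarith)
  -- part O-a′ (both runs at the base) and part M′'s gradient-piece rate (the step)
  obtain ⟨C₁, δ₁, D₁, hC₁, hδ₁, hD₁, H₁⟩ := fullPropD_decay_unif (d := d) L hLodd hL ha hm0
  obtain ⟨Cr, κ, hCr, hκ, Hr⟩ := ksDSlice_rate_unif (d := d) L hLodd hL ha hm0 hγ0 hγ1
  -- the constants of the theorem
  set Λ : ℝ := (L : ℝ) ^ (d + 1) / (L : ℝ) ^ 2 * L with hΛdef
  have hΛ : 0 < Λ := by positivity
  set δ : ℝ := min δ₁ κ with hδdef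
  have hδ : 0 < δ := lt_min hδ₁ hκ
  have hδ1' : δ ≤ δ₁ := min_le_left _ _
  have hδκ : δ ≤ κ := min_le_right _ _
  set C : ℝ := max (2 * C₁ * L) Cr with hCdef
  have hC : 0 < C := lt_max_of_lt_right hCr
  have hC1C : 2 * C₁ * L ≤ C := le_max_left _ _
  have hCrC : Cr ≤ C := le_max_right _ _
  set A : ℝ := 2 * Λ * L with hAdef
  have hA : 0 < A := by positivity
  set D₀ : ℝ := max D₁ (1 + A / (δ * ((L : ℝ) - 1))) with hD₀def
  have hD₀1 : 1 ≤ D₀ := hD₁.trans (le_max_left _ _)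
  have hD₀D₁ : D₁ ≤ D₀ := le_max_left _ _
  have hD₀A : 1 + A / (δ * ((L : ℝ) - 1)) ≤ D₀ := le_max_right _ _
  refine ⟨C, δ, D₀, hC, hδ, hD₀1, ?_⟩
  intro K hK
  induction K, hK using Nat.le_induction with
  | base =>
    intro n hn e M _ hM msq hmsq hcap μ x' y' hD
    set u := underPtN L 1 n M x' with hu
    set v := underPtN L 1 n M y' with hv
    set D : ℝ := tdistT M (blockOf (L ^ 1) M u) (blockOf (L ^ 1) M v) with hDdef
    have hDD₁ : D₁ ≤ D := hD₀D₁.trans hD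
    have hD0 : 0 ≤ D := tdistT_nonneg _ _ _
    -- the fine run: an `(1+n)`-level propagator, spelling `N = L^n·L^1`
    have hfine := H₁ (1 + n) (by omega) (L ^ n * L ^ 1) (by rw [pow_add, mul_comm]) e M hM msq hmsq hcap μ x' y'
      (by rwa [← blockOf_underPtN L 1 n M x', ← blockOf_underPtN L 1 n M y'])
    rw [← blockOf_underPtN L 1 n M x', ← blockOf_underPtN L 1 n M y'] at hfine
    -- the coarse run
    have hcoarse := H₁ 1 le_rfl (L ^ 1) rfl e M hM msq hmsq hcap μ u v hDD₁
    have hexp : Real.exp (-(δ₁ * D)) ≤ Real.exp (-(δ * D)) :=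
      Real.exp_le_exp.mpr (neg_le_neg (mul_le_mul_of_nonneg_right hδ1' hD0))
    have hθ1 : 2 * C₁ ≤ C * θ ^ 1 := by
      rw [pow_one]
      calc 2 * C₁ = 2 * C₁ * L * (L : ℝ)⁻¹ := by field_simp
        _ ≤ C * θ := mul_le_mul hC1C hθL (inv_pos.mpr hL0).le hC.le
    calc |((L ^ n * L ^ 1 : ℕ) : ℝ) *
              (constrainedProp (L ^ n * L ^ 1) M (aK a L (1 + n)) (((L ^ n * L ^ 1 : ℕ) : ℝ) ^ 2) msq
                  (x' + unitVec (fine (L ^ n * L ^ 1) M) μ) y'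
                - constrainedProp (L ^ n * L ^ 1) M (aK a L (1 + n)) (((L ^ n * L ^ 1 : ℕ) : ℝ) ^ 2) msq x' y')
            - ((L ^ 1 : ℕ) : ℝ) *
              (constrainedProp (L ^ 1) M (aK a L 1) (((L ^ 1 : ℕ) : ℝ) ^ 2) msq (u + unitVec (fine (L ^ 1) M) μ) v
                - constrainedProp (L ^ 1) M (aK a L 1) (((L ^ 1 : ℕ) : ℝ) ^ 2) msq u v)|
        ≤ |((L ^ n * L ^ 1 : ℕ) : ℝ) *
              (constrainedProp (L ^ n * L ^ 1) M (aK a L (1 + n)) (((L ^ n * L ^ 1 : ℕ) : ℝ) ^ 2) msq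
                  (x' + unitVec (fine (L ^ n * L ^ 1) M) μ) y'
                - constrainedProp (L ^ n * L ^ 1) M (aK a L (1 + n)) (((L ^ n * L ^ 1 : ℕ) : ℝ) ^ 2) msq x' y')|
            + |((L ^ 1 : ℕ) : ℝ) *
              (constrainedProp (L ^ 1) M (aK a L 1) (((L ^ 1 : ℕ) : ℝ) ^ 2) msq (u + unitVec (fine (L ^ 1) M) μ) v
                - constrainedProp (L ^ 1) M (aK a L 1) (((L ^ 1 : ℕ) : ℝ) ^ 2) msq u v)| := abs_sub _ _
      _ ≤ C₁ * Real.exp (-(δ₁ * D)) + C₁ * Real.exp (-(δ₁ * D)) := add_le_add hfine hcoarse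
      _ = 2 * C₁ * Real.exp (-(δ₁ * D)) := by ring
      _ ≤ C * θ ^ 1 * Real.exp (-(δ * D)) := mul_le_mul hθ1 hexp (Real.exp_pos _).le (by positivity)
  | succ K hK IH =>
    intro n hn e M _ hM msq hmsq hcap μ x'' y'' hD
    obtain rfl : M = fun _ => 2 * L ^ e := funext hM
    set i : KSliceIdx d := ⟨e, K, hK, n, hn, 0, Nat.zero_le e, 1, le_rfl⟩ with hidef
    have h : ∀ ν, fine (L ^ n * L ^ K * L) (ksM L i) ν = fine (L ^ n * L ^ (K + 1)) (ksM L i) ν :=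
      fine_assoc L K n (ksM L i)
    obtain ⟨x', rfl⟩ := ((flatten (L ^ n * L ^ K) L (ksM L i)).trans (torCongr h)).surjective x''
    obtain ⟨y', rfl⟩ := ((flatten (L ^ n * L ^ K) L (ksM L i)).trans (torCongr h)).surjective y''
    simp only [Equiv.trans_apply] at hD ⊢
    rw [underPtN_flatten L K n (ksM L i) h x', underPtN_flatten L K n (ksM L i) h y'] at hD ⊢
    set x := underPtN L K n (ksU L i) x' with hxdef
    set y := underPtN L K n (ksU L i) y' with hydef
    set D : ℝ := tdistT (fun _ : Fin (d + 1) => 2 * L ^ e)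
        (blockOf (L ^ (K + 1)) (fun _ : Fin (d + 1) => 2 * L ^ e) (flatten (L ^ K) L (ksM L i) x))
        (blockOf (L ^ (K + 1)) (fun _ : Fin (d + 1) => 2 * L ^ e) (flatten (L ^ K) L (ksM L i) y)) with hDdef
    set Dsub : ℝ := tdistT (ksU L i) (blockOf (L ^ K) (ksU L i) x) (blockOf (L ^ K) (ksU L i) y) with hDsubdef
    have hBx : blockOf (L ^ (K + 1)) (fun _ : Fin (d + 1) => 2 * L ^ e) (flatten (L ^ K) L (ksM L i) x)
        = blockOf L (ksM L i) (blockOf (L ^ K) (ksU L i) x) := blockOf_flatten (L ^ K) L (ksM L i) x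
    have hBy : blockOf (L ^ (K + 1)) (fun _ : Fin (d + 1) => 2 * L ^ e) (flatten (L ^ K) L (ksM L i) y)
        = blockOf L (ksM L i) (blockOf (L ^ K) (ksU L i) y) := blockOf_flatten (L ^ K) L (ksM L i) y
    have hgrow : (L : ℝ) * D ≤ Dsub + ((L : ℝ) - 1) := by
      rw [hDdef, hBx, hBy]
      exact mul_tdistT_blockOf_le L (ksM L i) (blockOf (L ^ K) (ksU L i) x) (blockOf (L ^ K) (ksU L i) y)
    have hD₀D : D₀ ≤ D := hD
    have hD1 : 1 ≤ D := hD₀1.trans hD₀D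
    have hDsub_ge : (L : ℝ) * (D - 1) + 1 ≤ Dsub := by linarith
    have hprod : 0 ≤ ((L : ℝ) - 1) * (D - 1) := mul_nonneg (by linarith) (by linarith)
    have hDsub_D₀ : D₀ ≤ Dsub := by linarith
    have hDsub0 : 0 ≤ Dsub := tdistT_nonneg _ _ _
    -- the mass one level down
    have hL2 : (0 : ℝ) < (L : ℝ) ^ 2 := by positivity
    have hm2 : 0 < msq / (L : ℝ) ^ 2 := div_pos hmsq hL2
    have hm2cap : msq / (L : ℝ) ^ 2 ≤ m0sq := by
      have h1 : (1 : ℝ) ≤ (L : ℝ) ^ 2 := one_le_pow₀ hL1'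
      exact (div_le_self hmsq.le h1).trans hcap
    -- the induction hypothesis on the finer cube for the differentiated sub-pair
    have hM' : ∀ μ, ksU L i μ = 2 * L ^ (e + 1) := fun μ => by
      show L * (2 * L ^ e) = 2 * L ^ (e + 1)
      ring
    have hIH : |((L ^ n * L ^ K : ℕ) : ℝ) *
            (constrainedProp (L ^ n * L ^ K) (ksU L i) (aK a L (K + n)) (((L ^ n * L ^ K : ℕ) : ℝ) ^ 2)
                (msq / (L : ℝ) ^ 2) (x' + unitVec (fine (L ^ n * L ^ K) (ksU L i)) μ) y'
              - constrainedProp (L ^ n * L ^ K) (ksU L i) (aK a L (K + n)) (((L ^ n * L ^ K : ℕ) : ℝ) ^ 2)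
                (msq / (L : ℝ) ^ 2) x' y')
          - ((L ^ K : ℕ) : ℝ) *
            (constrainedProp (L ^ K) (ksU L i) (aK a L K) (((L ^ K : ℕ) : ℝ) ^ 2) (msq / (L : ℝ) ^ 2)
                (x + unitVec (fine (L ^ K) (ksU L i)) μ) y
              - constrainedProp (L ^ K) (ksU L i) (aK a L K) (((L ^ K : ℕ) : ℝ) ^ 2) (msq / (L : ℝ) ^ 2) x y)|
        ≤ C * θ ^ K * Real.exp (-(δ * Dsub)) :=
      IH n hn (e + 1) (ksU L i) hM' (msq / (L : ℝ) ^ 2) hm2 hm2cap μ x' y' hDsub_D₀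
    -- part M′'s gradient-piece rate at the finer block distance
    have hS : |ksDSlice' L a (msq / (L : ℝ) ^ 2) i μ x' y' - ksDSlice L a (msq / (L : ℝ) ^ 2) i μ x y|
        ≤ Cr * θ ^ K * Real.exp (-(κ * Dsub)) := Hr (msq / (L : ℝ) ^ 2) hm2 hm2cap i μ x' y'
    have hS' : |ksDSlice' L a (msq / (L : ℝ) ^ 2) i μ x' y' - ksDSlice L a (msq / (L : ℝ) ^ 2) i μ x y|
        ≤ C * θ ^ K * Real.exp (-(δ * Dsub)) :=
      hS.trans (mul_le_mul (mul_le_mul_of_nonneg_right hCrC (pow_nonneg hθ0.le K))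
        (Real.exp_le_exp.mpr (neg_le_neg (mul_le_mul_of_nonneg_right hδκ hDsub0))) (Real.exp_pos _).le
        (by positivity))
    -- the pair of differentiated peels
    have hpeel := fullPropD_peel_pair_abs_le L hL ha hmsq i μ x' y' x y h
    -- the gain
    have hgainD : A ≤ δ * (((L : ℝ) - 1) * (D - 1)) := by
      have h1 : A / (δ * ((L : ℝ) - 1)) ≤ D - 1 := by linarith
      have h2 : 0 < δ * ((L : ℝ) - 1) := by positivity
      calc A ≤ (D - 1) * (δ * ((L : ℝ) - 1)) := (div_le_iff₀ h2).mp h1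
        _ = δ * (((L : ℝ) - 1) * (D - 1)) := by ring
    have hexp : Real.exp (-(δ * Dsub)) ≤ Real.exp (-(δ * D)) * Real.exp (-A) := by
      rw [← Real.exp_add]
      apply Real.exp_le_exp.mpr
      have h1 : δ * ((L : ℝ) * (D - 1) + 1) ≤ δ * Dsub := mul_le_mul_of_nonneg_left hDsub_ge hδ.le
      have h2 : δ * ((L : ℝ) * (D - 1) + 1) = δ * (((L : ℝ) - 1) * (D - 1)) + δ * D := by ring
      linarith
    have hAexp : A * Real.exp (-A) ≤ 1 := by
      have h1 : A ≤ Real.exp A := by linarith [Real.add_one_le_exp A]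
      rw [Real.exp_neg, ← div_eq_mul_inv, div_le_one (Real.exp_pos A)]
      exact h1
    have hgain : 2 * Λ * (C * θ ^ K * Real.exp (-(δ * Dsub))) ≤ C * θ ^ (K + 1) * Real.exp (-(δ * D)) := by
      have hAL : 2 * Λ = A * (L : ℝ)⁻¹ := by rw [hAdef]; field_simp
      calc 2 * Λ * (C * θ ^ K * Real.exp (-(δ * Dsub)))
          ≤ 2 * Λ * (C * θ ^ K * (Real.exp (-(δ * D)) * Real.exp (-A))) :=
            mul_le_mul_of_nonneg_left (mul_le_mul_of_nonneg_left hexp (by positivity)) (by positivity)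
        _ = (A * Real.exp (-A)) * (L : ℝ)⁻¹ * (C * θ ^ K * Real.exp (-(δ * D))) := by rw [hAL]; ring
        _ ≤ 1 * θ * (C * θ ^ K * Real.exp (-(δ * D))) :=
            mul_le_mul_of_nonneg_right (mul_le_mul hAexp hθL (inv_pos.mpr hL0).le zero_le_one) (by positivity)
        _ = C * θ ^ (K + 1) * Real.exp (-(δ * D)) := by rw [pow_succ]; ring
    -- assemble (written in the peels' spelling; the goal's `L^(K+1)`, `M_e` is the same term)
    calc |((L ^ n * L ^ (K + 1) : ℕ) : ℝ) *
              (constrainedProp (L ^ n * L ^ (K + 1)) (ksM L i) (aK a L (K + 1 + n))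
                  (((L ^ n * L ^ (K + 1) : ℕ) : ℝ) ^ 2) msq
                  (torCongr h (flatten (L ^ n * L ^ K) L (ksM L i) x') + unitVec (fine (L ^ n * L ^ (K + 1)) (ksM L i)) μ)
                  (torCongr h (flatten (L ^ n * L ^ K) L (ksM L i) y'))
                - constrainedProp (L ^ n * L ^ (K + 1)) (ksM L i) (aK a L (K + 1 + n))
                  (((L ^ n * L ^ (K + 1) : ℕ) : ℝ) ^ 2) msq
                  (torCongr h (flatten (L ^ n * L ^ K) L (ksM L i) x')) (torCongr h (flatten (L ^ n * L ^ K) L (ksM L i) y')))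
            - ((L ^ K * L : ℕ) : ℝ) *
              (constrainedProp (L ^ K * L) (ksM L i) (aK a L (K + 1)) (((L ^ K * L : ℕ) : ℝ) ^ 2) msq
                  (flatten (L ^ K) L (ksM L i) x + unitVec (fine (L ^ K * L) (ksM L i)) μ) (flatten (L ^ K) L (ksM L i) y)
                - constrainedProp (L ^ K * L) (ksM L i) (aK a L (K + 1)) (((L ^ K * L : ℕ) : ℝ) ^ 2) msq
                  (flatten (L ^ K) L (ksM L i) x) (flatten (L ^ K) L (ksM L i) y))|
        ≤ Λ * (|((L ^ n * L ^ K : ℕ) : ℝ) *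
                  (constrainedProp (L ^ n * L ^ K) (ksU L i) (aK a L (K + n)) (((L ^ n * L ^ K : ℕ) : ℝ) ^ 2)
                      (msq / (L : ℝ) ^ 2) (x' + unitVec (fine (L ^ n * L ^ K) (ksU L i)) μ) y'
                    - constrainedProp (L ^ n * L ^ K) (ksU L i) (aK a L (K + n)) (((L ^ n * L ^ K : ℕ) : ℝ) ^ 2)
                      (msq / (L : ℝ) ^ 2) x' y')
                - ((L ^ K : ℕ) : ℝ) *
                  (constrainedProp (L ^ K) (ksU L i) (aK a L K) (((L ^ K : ℕ) : ℝ) ^ 2) (msq / (L : ℝ) ^ 2)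
                      (x + unitVec (fine (L ^ K) (ksU L i)) μ) y
                    - constrainedProp (L ^ K) (ksU L i) (aK a L K) (((L ^ K : ℕ) : ℝ) ^ 2) (msq / (L : ℝ) ^ 2) x y)|
              + |ksDSlice' L a (msq / (L : ℝ) ^ 2) i μ x' y' - ksDSlice L a (msq / (L : ℝ) ^ 2) i μ x y|) := hpeel
      _ ≤ Λ * (C * θ ^ K * Real.exp (-(δ * Dsub)) + C * θ ^ K * Real.exp (-(δ * Dsub))) :=
          mul_le_mul_of_nonneg_left (add_le_add hIH hS') hΛ.le
      _ = 2 * Λ * (C * θ ^ K * Real.exp (-(δ * Dsub))) := by ring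
      _ ≤ C * θ ^ (K + 1) * Real.exp (-(δ * D)) := hgain

end Summit.QuantumFields.YangMills.BalabanUVNodes.N15KingModelRung.Curved
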